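import Mathlib.Data.Fintype.Basic
import Mathlib.Data.Multiset.Basic
import Mathlib.Data.Set.Countable
import HarnessLib

/-!
# Joshi, ATS III §4.3–4.5: Mochizuki's Adelic Ansatz as a divisorial correspondence and its STANDARD POINTS
# (block E «type Joshi's construction», slot T-08, OBJECTS.tsv O-020; file 1 of 3, sequels `AdelicAnsatzPeriod`, `AdelicAnsatzPeriodScaling`)

Record-only typing (D-0012) of K. Joshi, *Construction of Arithmetic Teichmüller Spaces III*,
arXiv:2401.13508v4 («[J-III]»; unrefereed, "Preliminary version for comments"), §4.3–§4.5, PDF pp. 35–36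
(render `HOME/lit/renders/Joshi-arxiv-2401.13508/p00NN.txt`; «p.N l.M» = line M of PDF page N), with the
upstream notions of *ATS II½*, arXiv:2305.10398 («[J-IIh]» = "[Joshi, 2023a]" of [J-III]; render
`HOME/plan/repair/lit/renders/Joshi-arxiv-2305.10398-ATS2half/`) these paragraphs quote: the adelic
Fargues–Fontaine curves `𝒴_L`, `𝒳_L` and the variant `𝒴′_L` ([J-IIh] Def. 4.1.1, Rmk. 4.1.3), correspondences
([J-IIh] §4.3), standard arithmeticoids ([J-IIh] §7.1). TAKES NO SIDE on [IUTchIII] Cor. 3.12, on Joshi's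
claims, or on any author; typed ≠ proved; typed AS A CANDIDATE ≠ endorsed; every statement print ASSERTS is a
`def … : Prop` tagged `@[claim "Joshi2024ATS3" "disputed"]` ("disputed" records that a dispute exists in print —
Mochizuki, Report on the preprints of K. Joshi, 2024-03 — and takes no side), never an axiom / `sorry` /
Literature fact; DATA Joshi defines are `structure`/`def`; a property that FOLLOWS from the typed signature is a
proved `theorem` (kernel glue, `[folklore]`).

## Contents (one declaration per printed item)
* `AnsatzCurveDatum` — INTERIM SELF-CONTAINED CARRIER (plan/E/ASSIGNMENTS §0.3) for what §4.3–4.5 use of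
  §4.1–4.2: `ℓ⋇`, the places `V_{L′} ⊇ V^non ⊇ V^{odd,ss}`, the closed classical points `|Y_{C♭_{p_w},L′_w}|`,
  `|X_{C♭_{p_w},L′_w}|` with the canonical quotient map and the CANONICAL POINT, and Mochizuki's Adelic Ansatz
  `Σ̃_{L′} ⊂ (𝒴′_{L′})^{ℓ⋇}` as an abstract subset ([J-III] (4.1.1)–(4.1.2), Def. 4.2.2). merge-debt: J3 §4.1–4.2
  = slot T-07 (`Joshi/AdelicAnsatz.lean`), J2h §4–5 = slot T-37 (`Joshi/Arithmeticoids.lean`); the later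
  filer imports the earlier landed structure BY NAME (E-PLAN R12).
* Prop. 4.3.1 (`ansatzDivisor`, `card_ansatzDivisor` — the degree count, proved), §4.4 STANDARD POINT
  (`IsStandardPoint`), Prop. 4.4.1 (`IsStandardPoint.quot_eq_canon` — definitional, proved), Rmk. 4.4.2
  (`StandardPointsCountable`, AS PRINTED), §4.5 the STANDARD POINT OF THE ANSATZ `z_Θ` (`IsStandardAnsatzPoint`,
  `StandardAnsatzPointExists`), the diagonal clause of Def. 4.2.2 as a predicate (`IsDiagonalOffBad`).

## Readings recorded for the faithfulness sheet (located, not adjudicated)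
(c) Rmk. 4.4.2's countability sentence is typed verbatim as a claim-Prop. (d) `𝒴_{L′}` vs `𝒴′_{L′}`: §4 works
with the variant `𝒴′` ("more convenient", p.30 l.26) but Prop. 4.3.1 / Def. 4.2.2 print `𝒴_{L′}`; one carrier.
(Readings (a), (b) concern Thm. 4.6.1 and are in the sequel.)

BINDING-POINT RULE (E-PLAN R14): this object file imports no `Cor312*`/`Thm311*` module and binds none of OUR
frozen declarations; dictionary row D-06 «`z_Θ` ↦ the q-pilot Kummer datum `qK`» lives in `Joshi/Dictionary.lean`
(`Dictionary.std`, landed), for which `AnsatzCurveDatum.AnsatzPt` / `IsStandardAnsatzPoint.toAnsatzPt` are the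
intended instantiation of `Dictionary.Pt` / `Dictionary.std`. Inputs ⊆ Mathlib; no FACT-LIST row consumed;
standard axioms only; sorry-free; nothing asserted. Seat abc-iut-E-t8 (rung LADDER-ABC:A2.E).
-/

noncomputable section

open Set

namespace Summit.ABC.IUTFork.Joshi

/-! ## 1. The carrier of §4.3–4.5: adelic curve, canonical points, Mochizuki's Adelic Ansatz -/

/-- INTERIM CARRIER for [J-III] §4.1–4.2 as consumed by §4.3–4.5 (merge-debt T-07 / T-37). Fields, with
locators: `ℓ⋇ = (ℓ−1)/2` for the prime `ℓ` of the Initial Theta Data ([J-III] §3.1 (11), p.28 l.5: "Let `ℓ ≥ 5` be a prime number, write `ℓ⋇ = (ℓ−1)/2`");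
`V` = the valuations `V_{L′}` of the number field `L′ ⊃ L` supplied by the Initial Theta Data ([J-III] §4.1,
p.30 l.21–28: "`L` … assumed to have no real embeddings … neither does `L′`"); `Vnon` = `V^non_{L′}`; `Voddss` =
`V^{odd,ss}_{L′} ⊆ V^non_{L′}` (the primes of odd residue characteristic and semi-stable reduction, [J-III] §3.1,
Def. 4.2.2 p.31 l.62–67); `Y w` = the closed classical points `|Y_{C♭_{p_w},L′_w}|` and `X w` = `|X_{C♭_{p_w},L′_w}|`
of the Fargues–Fontaine curves, so that `𝒴′_{L′} = ∏_w Y w`, `𝒳′_{L′} = ∏_w X w` ([J-IIh] Rmk. 4.1.3, p.20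
l.92–p.21 l.45; [J-III] (4.1.1) p.30 l.31–48); `quot w` = the canonical quotient morphism `Y → X` ([J-III] §4.4
p.35 l.46–61); `canon w` = the CANONICAL POINT of `X_{C♭_{p_w},L′_w}` ([J-III] §4.4 p.35 l.62–86 "this makes
sense for all `w ∈ V_{L′}` by [Joshi, 2023a]"; §5.2 p.38 l.38–40 "`t ∈ B` generates the maximal ideal of the
canonical point of `X_{C♭_p,ℚ_p}`"); `ansatz` = MOCHIZUKI'S ADELIC ANSATZ `Σ̃_{L′} ⊂ (𝒴′_{L′})^{ℓ⋇}` ([J-III]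
(4.1.2) p.30 l.49–60, Def. 4.2.2 p.31 l.51–81 — constructed by T-07; abstract here). Tuples are indexed by
`Fin ℓ⋇ = {0,…,ℓ⋇−1}` standing for Joshi's `j = 1,…,ℓ⋇` (`jOf`). SIGNATURE: nothing about Fargues–Fontaine
curves is assumed. [claim: Joshi2024ATS3, status: disputed] -/
structure AnsatzCurveDatum where
  /-- `ℓ⋇ = (ℓ − 1)/2` -/
  lstar : ℕ
  /-- `ℓ ≥ 5`, i.e. `ℓ⋇ ≥ 2` -/
  two_le_lstar : 2 ≤ lstar
  /-- the valuations `V_{L′}` -/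
  V : Type
  /-- `V^non_{L′}` -/
  Vnon : Set V
  /-- `V^{odd,ss}_{L′}` -/
  Voddss : Set V
  /-- `V^{odd,ss}_{L′} ⊆ V^non_{L′}` -/
  Voddss_subset_Vnon : Voddss ⊆ Vnon
  /-- `|Y_{C♭_{p_w}, L′_w}|` (closed classical points) -/
  Y : V → Type
  /-- `|X_{C♭_{p_w}, L′_w}|` -/
  X : V → Type
  /-- the canonical quotient morphism `Y_{C♭_{p_w},L′_w} → X_{C♭_{p_w},L′_w}` on closed classical points -/
  quot : ∀ w, Y w → X w
  /-- the canonical point of `X_{C♭_{p_w},L′_w}` -/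
  canon : ∀ w, X w
  /-- Mochizuki's Adelic Ansatz `Σ̃_{L′} ⊂ (𝒴′_{L′})^{ℓ⋇}` -/
  ansatz : Set (Fin lstar → ∀ w, Y w)

namespace AnsatzCurveDatum

variable (A : AnsatzCurveDatum)

/-- A point `y = (y_w)_{w ∈ V_{L′}}` of the adelic curve `𝒴′_{L′} = ∏_w |Y_{C♭_{p_w},L′_w}|` ([J-III] (4.1.1);
[J-IIh] Def. 5.1.1: "an arithmeticoid of `L` … is a point `y ∈ 𝒴_L`"). [claim: Joshi2024ATS3, status: disputed] -/
abbrev AdelicPoint : Type := ∀ w : A.V, A.Y w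

/-- An `ℓ⋇`-tuple `z = (y_1, …, y_{ℓ⋇}) ∈ (𝒴′_{L′})^{ℓ⋇}` ([J-III] (4.1.2), p.31 l.36–47).
[claim: Joshi2024ATS3, status: disputed] -/
abbrev Tuple : Type := Fin A.lstar → A.AdelicPoint

/-- The points of Mochizuki's Adelic Ansatz `Σ̃_{L′}` as a type (intended instantiation of `Dictionary.Pt`,
file `Joshi/Dictionary.lean`). [claim: Joshi2024ATS3, status: disputed] -/
abbrev AnsatzPt : Type := {z : A.Tuple // z ∈ A.ansatz}

/-- Joshi's label `j ∈ {1, …, ℓ⋇}` of the tuple index `i ∈ Fin ℓ⋇` (`j = i + 1`). [folklore] -/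
def jOf (i : Fin A.lstar) : ℕ := (i : ℕ) + 1

/-- The index of `y_1`. [folklore] -/
def first : Fin A.lstar := ⟨0, by have := A.two_le_lstar; omega⟩

/-- The index of `y_{ℓ⋇}`. [folklore] -/
def last : Fin A.lstar := ⟨A.lstar - 1, by have := A.two_le_lstar; omega⟩

/-- `jOf first = 1`. [folklore] -/
@[simp] theorem jOf_first : A.jOf A.first = 1 := rfl

/-- `jOf last = ℓ⋇`. [folklore] -/
theorem jOf_last : A.jOf A.last = A.lstar := by
  have := A.two_le_lstar; simp only [jOf, last]; omega

/-- `y_1` and `y_{ℓ⋇}` are different coordinates (`ℓ⋇ ≥ 2`). [folklore] -/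
theorem first_ne_last : A.first ≠ A.last := by
  intro h; have h' := congrArg Fin.val h; have := A.two_le_lstar
  simp only [first, last] at h'; omega

/-- `j ≥ 2` for every index other than `first`. [folklore] -/
theorem two_le_jOf {i : Fin A.lstar} (hi : i ≠ A.first) : 2 ≤ A.jOf i := by
  have : (i : ℕ) ≠ 0 := fun h => hi (Fin.ext (by simpa [first] using h))
  simp only [jOf]; omega

/-! ### Prop. 4.3.1 — the Ansatz as a divisorial correspondence -/

/-- **[J-III] Prop. 4.3.1 (p.35 l.5–21), the divisor**: "Each point `z = (y′_1, y′_2, …, y′_{ℓ⋇}) ∈ Σ̃_{L′}` defines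
a divisorial correspondence `y′_1 ↦ Σ_{j=1}^{ℓ⋇} (y′_j) = (y′_1) + (y′_2) + ⋯ + (y′_{ℓ⋇})` on `𝒴_{L′}` of degree `ℓ⋇`"
— the formal sum `Σ_j (y′_j)` as an effective 0-cycle (multiset of points; "correspondence" in the sense of
[J-IIh] §4.3, Thm. 4.3.1 p.25 l.27–33: "one-to-many mapping (written as a finite formal sum over points)").
Defined for every tuple; Prop. 4.3.1 applies it to `z ∈ Σ̃_{L′}`. [claim: Joshi2024ATS3, status: disputed] -/
def ansatzDivisor (z : A.Tuple) : Multiset A.AdelicPoint :=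
  (Finset.univ : Finset (Fin A.lstar)).val.map z

/-- **[J-III] Prop. 4.3.1, the correspondence** `y′_1 ↦ Σ_j (y′_j)`: source point and divisor.
[claim: Joshi2024ATS3, status: disputed] -/
def ansatzCorrespondence (z : A.Tuple) : A.AdelicPoint × Multiset A.AdelicPoint :=
  (z A.first, A.ansatzDivisor z)

/-- **[J-III] Prop. 4.3.1, "of degree `ℓ⋇`"** — PROVED over the signature (the degree of `Σ_{j=1}^{ℓ⋇} (y′_j)`
is `ℓ⋇` by count; the geometric content of the printed proof, "clear from the construction of `Σ̃_{L′}` and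
[J-IIh] §4.3", i.e. that the correspondence arises from `σ ∈ ∏_p Aut_{ℤ_p}(1 + 𝔪_{O_{C♭_p}})` as in [J-IIh]
Thm. 4.3.1, is NOT asserted here). [folklore] -/
theorem card_ansatzDivisor (z : A.Tuple) : Multiset.card (A.ansatzDivisor z) = A.lstar := by
  simp [ansatzDivisor]

/-- Every coordinate `y′_j` occurs in the divisor of `z`. [folklore] -/
theorem mem_ansatzDivisor (z : A.Tuple) (i : Fin A.lstar) : z i ∈ A.ansatzDivisor z := by
  simp only [ansatzDivisor, Multiset.mem_map, Finset.mem_val, Finset.mem_univ, true_and]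
  exact ⟨i, rfl⟩

/-! ### §4.4 — the standard point of `𝒴′_{L′}`; Prop. 4.4.1; Rmk. 4.4.2 -/

/-- **[J-III] §4.4, STANDARD POINT (p.35 l.24–98)**: "I will choose a point `y_0 ∈ 𝒴_{L′}` (resp. `y′_0 ∈ 𝒴′_{L′}`),
which will be referred to as the standard point … The choice of `y_0 = (y_w)_{w ∈ V_{L′}}` (resp. `y′_0 = (y′_w)`)
is such that each `y_w` (resp. `y′_w ∈ Y_{C♭_p,L′_w}`) is a closed classical point in the fiber of the canonical
quotient morphism `Y → X` such that the image of this chosen point … is the canonical point of `X` (this makes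
sense for all `w ∈ V_{L′}` by [Joshi, 2023a])"; construction for `L` in [J-IIh] §7.1 (p.46 l.10–32: the condition
is imposed "for each prime `v ∈ V^non_L`"; "for `v ∈ V^arc_L`, let `y_v` be any point"; "`arith(L)_{y_0}` is not
unique!"). Typed as the predicate on adelic points; the residue-field clause ("naturally identified with `C_p`
… with a natural action of `G_{L′_w}`", p.35 l.87–97) is carrier information of `ArithPeriodDatum`, not a
condition. [claim: Joshi2024ATS3, status: disputed] -/
def IsStandardPoint (y₀ : A.AdelicPoint) : Prop :=
  ∀ w ∈ A.Vnon, A.quot w (y₀ w) = A.canon w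

/-- The set of standard points of `𝒴′_{L′}` ([J-III] §4.4; Rmk. 4.4.2 "possible choices for the standard point").
[claim: Joshi2024ATS3, status: disputed] -/
def standardPoints : Set A.AdelicPoint := {y₀ | A.IsStandardPoint y₀}

/-- §4.4 rephrased: `y₀` is standard iff each non-archimedean coordinate lies in the fibre of `Y → X` over the
canonical point. [folklore] -/
theorem isStandardPoint_iff_mem_fibre (y₀ : A.AdelicPoint) :
    A.IsStandardPoint y₀ ↔ ∀ w ∈ A.Vnon, y₀ w ∈ A.quot w ⁻¹' {A.canon w} := by
  simp [IsStandardPoint]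

/-- **[J-III] Prop. 4.4.1 (p.35 l.99–108)**: "Let `y′_0 = (y′_w)_{w ∈ V_{L′}}` be a standard point of `𝒴′_{L′}`. Then
for each `w ∈ V^non_{L′}`, the image of `y′_w` under the canonical quotient morphism `𝒴′_{L′} → 𝒳′_{L′}` is the
canonical point of `𝒳′_{L′}`." PROVED: it is the defining condition of §4.4 ("The above discussion is summarized
in the following", p.35 l.97–98). [folklore] -/
theorem IsStandardPoint.quot_eq_canon {A : AnsatzCurveDatum} {y₀ : A.AdelicPoint}
    (h : A.IsStandardPoint y₀) {w : A.V} (hw : w ∈ A.Vnon) : A.quot w (y₀ w) = A.canon w :=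
  h w hw

/-- **[J-III] Rmk. 4.4.2 (p.36 l.1–10), AS PRINTED**: "there are countably infinite possible choices for the
standard point `y_0` (resp. `y′_0`). This is because the set of valuations `V_L` of any number field `L` is
countable and for each `v ∈ V_L`, the set of possible choices of closed classical points `y_v` (chosen as above)
is countable hence the set of `y_0 = (y_v)_{v ∈ V_L}` as above is countable. However … the choice … is not unique.
Any one of the countably many choices for `y_0` are equally valid … each choice sees `p`-adic arithmetic (and
geometry) slightly differently … and so one can average over such choices." Typed verbatim as "the set of
standard points is countable and infinite". For the faithfulness sheet (no adjudication): the printed "hence"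
passes from countability of the index set `V_L` and of each fibre to countability of the set of SECTIONS
`(y_v)_v`. HYPOTHESIS, never asserted. [claim: Joshi2024ATS3, status: disputed] -/
@[claim "Joshi2024ATS3" "disputed"]
def StandardPointsCountable : Prop := A.standardPoints.Countable ∧ A.standardPoints.Infinite

/-! ### §4.5 — the standard point `z_Θ` of Mochizuki's Ansatz -/

/-- **[J-III] §4.5 (p.36 l.11–17), STANDARD POINT OF MOCHIZUKI'S ANSATZ**: "Now I will choose a standard point of
`z_Θ ∈ Σ̃_{L′}` which one may think of as a standard Θ-Link (for the purposes of [IUTchI–III]). Let `z_Θ =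
(y_1, y_2, …, y_{ℓ⋇}) ∈ Σ̃_{L′}` be chosen such that `y_{ℓ⋇} = y′_0 ∈ 𝒴′_{L′}` is the standard point of `𝒴′_{L′}` chosen
in §4.4." The predicate "`z` is such a choice". This is the object the proof of [J-III] Thm. 7.3.1 evaluates
(p.56 l.29–37) and that dictionary row D-06 (plan/E/E-PLAN.md §3) sends to the q-pilot Kummer datum `qK` of
`Cor312Vol.PilotKummerIndRelated` — bound ONLY in `Joshi/Dictionary.lean` (`Dictionary.std`).
[claim: Joshi2024ATS3, status: disputed] -/
def IsStandardAnsatzPoint (z : A.Tuple) : Prop :=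
  z ∈ A.ansatz ∧ A.IsStandardPoint (z A.last)

/-- The set of standard points of the Ansatz ("standard Θ-Links", [J-III] §4.5). [claim: Joshi2024ATS3, status: disputed] -/
def standardAnsatzPoints : Set A.Tuple := {z | A.IsStandardAnsatzPoint z}

/-- A standard Ansatz point is a point of `Σ̃_{L′}`. [folklore] -/
theorem IsStandardAnsatzPoint.mem_ansatz {A : AnsatzCurveDatum} {z : A.Tuple} (h : A.IsStandardAnsatzPoint z) :
    z ∈ A.ansatz := h.1

/-- Its last coordinate `y_{ℓ⋇}` is a standard point of `𝒴′_{L′}` (hence, by Prop. 4.4.1, lies over the canonical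
points). [folklore] -/
theorem IsStandardAnsatzPoint.last_standard {A : AnsatzCurveDatum} {z : A.Tuple}
    (h : A.IsStandardAnsatzPoint z) : A.IsStandardPoint (z A.last) := h.2

/-- A standard Ansatz point as an element of `AnsatzPt` (the intended `Dictionary.std`). [folklore] -/
def IsStandardAnsatzPoint.toAnsatzPt {A : AnsatzCurveDatum} {z : A.Tuple} (h : A.IsStandardAnsatzPoint z) :
    A.AnsatzPt := ⟨z, h.1⟩

/-- **[J-III] §4.5, the implicit existence claim**: "Let `z_Θ = (y_1, …, y_{ℓ⋇}) ∈ Σ̃_{L′}` be chosen such that `y_{ℓ⋇} =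
y′_0`" presupposes that the last projection `Σ̃_{L′} → 𝒴′_{L′}` meets the standard points (for the chosen `y′_0`;
typed: for some standard point). HYPOTHESIS, never asserted; T-07's construction of `Σ̃_{L′}` (Def. 4.2.2 via the
local Ansatz of [J-IIp] §6) is where it would be discharged. [claim: Joshi2024ATS3, status: disputed] -/
@[claim "Joshi2024ATS3" "disputed"]
def StandardAnsatzPointExists : Prop := ∃ z : A.Tuple, A.IsStandardAnsatzPoint z

/-- **[J-III] Def. 4.2.2, the diagonal clause (p.31 l.54–63)**, as far as Thm. 4.6.1 (4) uses it: off
`V^{odd,ss}_{L′}` the `w`-component of `z` is diagonal, "`z_w = (y_w, y_w, …, y_w)` if `w ∈ V_{L′} − V^{odd,ss}`".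
A predicate on tuples (T-07 types the full definition); hypothesis of `diagonalOnL_of_isDiagonalOffBad`.
[claim: Joshi2024ATS3, status: disputed] -/
def IsDiagonalOffBad (z : A.Tuple) : Prop :=
  ∀ w, w ∉ A.Voddss → ∀ i : Fin A.lstar, z i w = z A.first w

end AnsatzCurveDatum


end Summit.ABC.IUTFork.Joshi
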